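import Literature.NumberTheory.LFunctions.RodgersTaoTruncEnergyLemma18Proofs
import Literature.NumberTheory.LFunctions.RodgersTaoNearbySumsProofs
import Mathlib.Analysis.SpecialFunctions.Pow.Real
import HarnessLib

/-!
# Rodgers–Tao 2020, Proposition 22 — the energy side of the main-term analysis:
`Ẽ_T = X₁ − X′₁ + negligible` (display (82), FMP p. 52; v5 TeX label `mang`) — RH-FREE CONTENT

Proofs only: no named facts and no `def`s. Trunk T-ANT (`Literature/NumberTheory/LFunctions`).

Source: B. Rodgers, T. Tao, *The de Bruijn–Newman constant is non-negative*, Forum Math. Pi 8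
(2020) e6 = arXiv:1801.05914, §7, proof of **Proposition 22** (= v4 Prop. 7.7), FMP p. 52
(= v5 TeX l. 1313–1326, label `mang`; FMP page OPENED, rt/src/RodgersTao2020_FMP8e6_pages/p0052.txt
l. 50–64): «From Lemma 18, we see that `Ẽ_T` is equal to
`X₁ − X′₁ + Σ_{j,k : j ≁_T k, j ≠ k} ψ_T(j)ψ_T(k)(1/(x_k − x_j)² − 1/(ξ_k − ξ_j)²)` (82)
up to negligible terms. From (43), (44) we have
`1/(x_k − x_j)² − 1/(ξ_k − ξ_j)² ≲ log₊^{O(1)}(|j| + |k|)/|k − j|³` when `j ≠ k` and `j ≁_T k`, so the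
final term in (82) is negligible.» Here `X₁ := Σ_{j,k : j ∼_T k} ψ_T(j)ψ_T(k)/(x_k − x_j)²` (FMP p. 50,
after (80); v5 l. 1262) and `X′₁ := Σ_{j,k : j ∼_T k} ψ_T(j)ψ_T(k)/(ξ_k − ξ_j)²` (p. 52, after (81); v5 l. 1313),
«negligible» `= o_{T→∞}(T log³₊ T + Ẽ_T(t))` (p. 47), and `j ∼_T k` is the nearby relation of
§1.2 (`0 < |j − k| < (T² + |j| + |k|)^{0.1}`).

LINE 1 — LABEL. **RH-FREE CONTENT** (0 named facts, 0 `def`s, 0 sorries): statements about the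
zeros `x_j(t)` of `H_t` at ONE time `t` lying above a real-rooted time (so that the `ℤ*`-indexed
zeros are the genuine simple real zeros and (63) holds) at which they obey a (50)-shape location law
`|x_n(t) − ξ_n| ≤ B log₊ ξ_n` (`n ≥ 1`) TAKEN AS A HYPOTHESIS — the INNER shape of
`RodgersTao2020.cor33_location`, verbatim the binder of the Lemma 18 schema
`rodgers_tao_truncEnergy_expansion_of` — and, in the last theorem, under
`RodgersTao2020.cor33_location` itself (CONTENT-proved in the tree, `cor33_location_content`,
Dobner-free). Nothing is asserted about `Λ`; no use is made of `Λ ≥ 0`; the as-printed record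
`rodgers_tao_truncHamiltonian_deriv` (Prop. 22, VACUOUS-AS-PRINTED / EX-FALSO class) is NOT touched
and no second `_holds` is declared for anything. bears_on: N-C/N-P (COLUMN 3 DBN).
WHAT THIS IS NOT: not Proposition 22 (the derivative side — absolute continuity of `H̃_T`, the
(77)/(78) identities, and the `X₂`, `X₃ − X′₃`, `X₄`, (81) analysis of pp. 48–53 —
is not in this file); not a statement at `t = 0` alone, not a statement about `H_0` or `ζ`, not
progress toward RH — formalising the printed step fixes which inputs (Lemma 18, (43)–(44), (50),
(66)) it needs; nothing in this file bears on the truth of the Riemann hypothesis.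

## Contents (source item → declaration → status; namespace `Literature.NumberTheory.LFunctions`)

* §1.2 p. 7 (definition of `∼_T`) → `RodgersTaoTruncEnergyNearby.nonNearby_radius`: for a
  NON-nearby pair `j ≠ k` and `T ≥ 3`, with `ρ := (T² + |j| + |k|)^{1/10}`: `ρ ≤ |k − j|`,
  `ρ^{10} = T² + |j| + |k|`, `1 ≤ ρ`, `log₊(|j| + |k|) ≤ 10 log ρ`, and `R ≤ ρ` whenever
  `R^{10} ≤ T²`. PROVED. (This is where «`j ≁_T k`» enters: the distance `|k − j|` dominates every
  power of `log₊(|j| + |k|)` and of `log T`.)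
* p. 52, «from (43), (44) … `≲ log₊^{O(1)}(|j|+|k|)/|k − j|³` when `j ≠ k` and `j ≁_T k`» →
  `RodgersTaoTruncEnergyNearby.abs_interactionEnergy_sub_inv_sq_le` (termwise, explicit: at a time
  `t` with the (50)-law, for a non-nearby off-diagonal pair with
  `400·max(B,0)·C₈·C₄₄·log² ρ ≤ ρ`: `|(x_k − x_j) − (ξ_k − ξ_j)| ≤ |ξ_k − ξ_j|/2` and
  `|E_{jk}(t) − 1/(ξ_k − ξ_j)²| ≤ 20·max(B,0)·C₈·C₄₄³ · log₊⁴(|j|+|k|)/|k − j|³`, `C₄₄`, `C₈` the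
  constants of (44), (43)) and `RodgersTaoTruncEnergyNearby.nonNearby_comparable` (the same with the
  threshold in `T`: `∃ K, ∀ B, ∃ T₀, ∀ T ≥ T₀ …`). PROVED (CONTENT).
* p. 52, «so the final term in (82) is negligible» →
  `RodgersTaoTruncEnergyNearby.abs_tsum_nonNearby_le`: for every `B` and `ε > 0` there is `T₁`
  (independent of `t`) such that for `T ≥ T₁` and every `t` with the (50)-law the family
  `p ↦ 𝟙[j ≁_T k] ψ_T(j)ψ_T(k)(E_{jk}(t) − 1/(ξ_k − ξ_j)²)` on the pairs `j ≠ k` of `ℤ*` is summable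
  (no finiteness hypothesis on `Ẽ_T(t)`) and `|Σ'| ≤ ε · T log³ T`. PROVED (CONTENT).
* §1.2 / (69) bookkeeping → `RodgersTaoTruncEnergyNearby.summable_nearby_part_iff`: for any
  `G : ℤ × ℤ → ℝ`, the family `𝟙[j ∼_T k] G` on the pairs `j ≠ k` of `ℤ*` is summable iff `G` is
  summable on `nearbyPairs T`, with the same sum (nearby pairs are off-diagonal). PROVED. The
  constants of (43)–(44) used throughout are packaged in `RodgersTaoTruncEnergyNearby.exists_constants`
  (from `exists_inv_abs_sub_classicalLocationZ_le` and `RodgersTaoTruncEnergyExpansion.exists_constants`).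
* p. 52, display (82) → `RodgersTaoTruncEnergyNearby.truncEnergy_nearby_reduction` (the schema,
  pointwise in `t`): for every `B`, `ε > 0` there is `T₁` such that for `T ≥ T₁` and every `t` above a
  real-rooted time with the (50)-law: `X′₁` is finite; `Ẽ_T(t)` is finite (summable) iff `X₁(t)` is;
  and if so `|Ẽ_T(t) − (X₁(t) − X′₁)| ≤ ε · T log³ T`. PROVED (CONTENT) — from the Lemma 18 schema
  `rodgers_tao_truncEnergy_expansion_of` (its `Õ(1) = C·max(B,0)·log⁶ T`) and the previous item.
* the same on the printed range → `truncEnergy_nearby_reduction_of_cor33_location`: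
  `RodgersTao2020.cor33_location → ∀ t₀ < 0, H_{t₀} real-rooted → ∀ ε > 0, ∃ T₁, ∀ T ≥ T₁,
  ∀ t ∈ [t₀/2, 0], …` (the as-printed reduction; both sides VACUOUS-AS-PRINTED in the tree, the
  implication is RH-free content; fed with `cor33_location_content` it is a Dobner-free proof term of
  the printed step). PROVED (CONTENT).

## Proof route and divergences (rt/REFEREE §6)

* The printed «(43), (44)» step, made explicit: a non-nearby pair has
  `|k − j| ≥ ρ := (T² + |j| + |k|)^{1/10}`, hence `log₊(|j| + |k|) ≤ log(T² + |j| + |k|) = 10 log ρ`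
  (`T² ≥ 2`); by (50) and (43) (`abs_deviation_le`: `|x_n − ξ_n| ≤ max(B,0) C₈ log₊ n` on `ℤ`)
  `|(x_k − x_j) − (ξ_k − ξ_j)| ≤ 2 max(B,0) C₈ log₊(|j|+|k|)`, and by (44)
  (`exists_inv_abs_sub_classicalLocationZ_le`) `|ξ_k − ξ_j| ≥ |k − j|/(C₄₄ log₊(|j|+|k|))`; so once
  `400 max(B,0) C₈ C₄₄ log² ρ ≤ ρ` (true for `ρ ≥ R₀(B)`, i.e. for `T ≥ R₀(B)⁵`, since `ρ^{10} ≥ T²`)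
  the deviation is at most half of `|ξ_k − ξ_j|`, and `|1/a² − 1/b²| ≤ 10δ/|b|³`
  (`|a − b| ≤ δ ≤ |b|/2`) gives `|E_{jk} − 1/(ξ_k − ξ_j)²| ≤ 20 max(B,0) C₈ C₄₄³ log₊⁴(|j|+|k|)/|k − j|³`
  — the printed `≲ log₊^{O(1)}(|j|+|k|)/|k − j|³` with the exponent `4` and the `B`-dependence
  explicit.
* «negligible»: `log₊⁴(|j|+|k|)/|k − j|³ ≤ 10⁴ (log⁴ ρ/ρ) · 1/(k − j)²` and `log⁴ ρ/ρ ≤ η` for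
  `ρ ≥ R₁(η)` (again a threshold `T ≥ R₁⁵`); with `ψ_T(k) ≤ 1` the family is dominated by
  `K η ψ_T(j)/(k − j)²`, whose sum over `ℤ × ℤ` is `K η (Σ_j ψ_T(j))(Σ_{d ∈ ℤ} 1/d²) ≤ K η · 10 T log T · S₂`
  (shear `(j,k) ↦ (j, k − j)`, `tsum_truncWeight_mul_logPlus_pow_le` at `p = 0`); `η := ε/(10 K S₂ + 1)`
  gives `≤ ε T log T ≤ ε T log³ T`. So the non-nearby remainder is in fact `O_B(T^{1−c})` for any
  `c < 1/5`; only the printed «negligible» (`o(T log³ T)`, rate uniform in `t`) is recorded.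
* (82) itself: Lemma 18 in the schema form `rodgers_tao_truncEnergy_expansion_of` (rt-t7) gives,
  pointwise in `t`, `Ẽ_T(t)` finite iff `Σ_{j ≠ k} ψψ(E_{jk} − 1/Δξ²)` summable, and then
  `|Ẽ_T − Σ'| ≤ C max(B,0) log⁶ T`; splitting the off-diagonal pairs into nearby and non-nearby ones
  (`tsum_subtype_eq_of_support_subset`, `tsum_subtype`, indicators on `ℤ × ℤ`) and using the
  `t`-free finiteness of `X′₁ ≤ Σ_{j ≠ k} ψψ/(ξ_j − ξ_k)²` (`rodgers_tao_truncWeight_xi_sq_sum_bound_holds`,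
  the RH-free display of p. 48) yields the three clauses; `C max(B,0) log⁶ T ≤ (ε/2) T log³ T` for
  `T ≥ R₂(B, ε)`.
* Divergences: none in substance. «negligible» carries no `+ Ẽ_T(t)` term here (the bound is the
  stronger `o(T log³ T)`, uniformly in `t`); `T log³ T` renders `T log³₊ T` («`T` large», p. 42, as in
  `RodgersTaoHamiltonian.lean`); `X₁` is written with `E_{jk} = 1/(x_j − x_k)² = 1/(x_k − x_j)²`
  (`interactionEnergy`); the printed «almost every `t`» of Lemma 18 is, as in the Lemma 18 schema,
  only the finiteness hypothesis `Summable (truncEnergyTerm T t)` of the last clause.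

## References

* B. Rodgers, T. Tao, *The de Bruijn–Newman constant is non-negative*, Forum Math. Pi 8 (2020)
  e6, §7 Prop. 22 p. 48 (76), proof pp. 48–53: (80) and `X₁,…,X₄` p. 50, (81), (82) and the sentence
  after it p. 52; Lemma 18 p. 42, Lemma 21 proof p. 48 (first display), (66)–(67) p. 42; §3 Lemma 8
  (43)–(44) p. 21, Corollary 10 (50) p. 23; §1.2 p. 7 (`∼_T`, `log₊`, `≲`), «negligible» p. 47
  = arXiv:1801.05914v4 Prop. 7.7, v5 TeX l. 1262, 1313–1326 (labels `sumjk`, `sumjk-2`, `mang`).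
* A. Dobner, *A proof of Newman's conjecture for the extended Selberg class*, Acta Arith. 201
  (2021) 29–62 (the tree's route to `Λ ≥ 0`, which makes the as-printed Prop. 22 vacuous).
-/

noncomputable section

open Real Set Filter Topology
open scoped Classical

namespace Literature.NumberTheory.LFunctions

namespace RodgersTaoTruncEnergyNearby

/-! ### §0 Elementary tools -/

/-- `(x^{1/10})^{10} = x` for `x ≥ 0`. [folklore] -/
private theorem rpow_tenth_pow_ten {x : ℝ} (hx : 0 ≤ x) : (x ^ (1 / 10 : ℝ)) ^ 10 = x := by
  rw [← Real.rpow_natCast, ← Real.rpow_mul hx]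
  norm_num

/-- For every `C` and `n` there is `R₀ ≥ 1` with `C · logⁿ x ≤ x` for all `x ≥ R₀` (`logⁿ x = o(x)`).
[folklore] -/
private theorem exists_mul_log_pow_le (C : ℝ) (n : ℕ) :
    ∃ R₀ : ℝ, 1 ≤ R₀ ∧ ∀ x : ℝ, R₀ ≤ x → C * Real.log x ^ n ≤ x := by
  rcases le_or_gt C 0 with hC | hC
  · refine ⟨1, le_rfl, fun x hx ↦ ?_⟩
    have h1 : 0 ≤ Real.log x ^ n := pow_nonneg (Real.log_nonneg hx) n
    nlinarith
  · have hev := (Real.isLittleO_pow_log_id_atTop (n := n)).def (show (0 : ℝ) < 1 / C by positivity)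
    obtain ⟨R, hR⟩ := Filter.eventually_atTop.1 hev
    refine ⟨max R 1, le_max_right _ _, fun x hx ↦ ?_⟩
    have hx1 : 1 ≤ x := le_trans (le_max_right _ _) hx
    have h := hR x (le_trans (le_max_left _ _) hx)
    simp only [id_eq, Real.norm_eq_abs] at h
    rw [abs_of_nonneg (pow_nonneg (Real.log_nonneg hx1) n), abs_of_nonneg (by linarith)] at h
    calc C * Real.log x ^ n ≤ C * (1 / C * x) := mul_le_mul_of_nonneg_left h hC.le
      _ = x := by field_simp

/-- If `|a − b| ≤ δ ≤ |b|/2` and `b ≠ 0` then `|1/a² − 1/b²| ≤ 10 δ/|b|³`. [folklore] -/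
private theorem abs_inv_sq_sub_inv_sq_le {a b δ : ℝ} (hab : |a - b| ≤ δ) (hδ : δ ≤ |b| / 2)
    (hb : b ≠ 0) : |1 / a ^ 2 - 1 / b ^ 2| ≤ 10 * δ / |b| ^ 3 := by
  have hb0 : 0 < |b| := abs_pos.2 hb
  have hδ0 : 0 ≤ δ := (abs_nonneg _).trans hab
  have h1 : |b| - |a| ≤ δ := by
    have := abs_sub_abs_le_abs_sub b a
    rw [abs_sub_comm] at this
    linarith
  have h2 : |a| - |b| ≤ δ := (abs_sub_abs_le_abs_sub a b).trans hab
  have ha_lower : |b| / 2 ≤ |a| := by linarith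
  have ha0 : 0 < |a| := lt_of_lt_of_le (by positivity) ha_lower
  have ha : a ≠ 0 := abs_pos.1 ha0
  have hid : 1 / a ^ 2 - 1 / b ^ 2 = (b - a) * (b + a) / (a ^ 2 * b ^ 2) := by
    field_simp
    ring
  rw [hid, abs_div, abs_mul, abs_mul, abs_pow, abs_pow]
  have hnum : |b - a| * |b + a| ≤ δ * (5 * |b| / 2) := by
    have e1 : |b - a| ≤ δ := by rw [abs_sub_comm]; exact hab
    have e2 : |b + a| ≤ 5 * |b| / 2 := (abs_add_le b a).trans (by linarith)
    exact mul_le_mul e1 e2 (abs_nonneg _) hδ0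
  have hden : (|b| / 2) ^ 2 * |b| ^ 2 ≤ |a| ^ 2 * |b| ^ 2 :=
    mul_le_mul_of_nonneg_right (pow_le_pow_left₀ (by positivity) ha_lower 2) (by positivity)
  calc |b - a| * |b + a| / (|a| ^ 2 * |b| ^ 2)
      ≤ δ * (5 * |b| / 2) / ((|b| / 2) ^ 2 * |b| ^ 2) :=
        div_le_div₀ (by positivity) hnum (by positivity) hden
    _ = 10 * δ / |b| ^ 3 := by
        field_simp
        ring

/-- `1 ≤ log T` and `0 < T log T` for `T ≥ 3`. [folklore] -/
private theorem one_le_log_of_three_le' {T : ℝ} (hT : 3 ≤ T) :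
    1 ≤ Real.log T ∧ 0 < T * Real.log T := by
  have hT0 : 0 < T := by linarith
  have hlogT : 1 ≤ Real.log T := by
    rw [← Real.log_exp 1]
    exact Real.log_le_log (Real.exp_pos 1) (by have := Real.exp_one_lt_d9; linarith)
  exact ⟨hlogT, by positivity⟩

/-! ### §1 Non-nearby pairs: the radius `ρ = (T² + |j| + |k|)^{1/10}` -/

/-- For a NON-nearby pair `j ≠ k` (§1.2: `j ∼_T k` iff `0 < |j − k| < (T² + |j| + |k|)^{0.1}`) and
`T ≥ 3`, with `ρ := (T² + |j| + |k|)^{1/10}`: `ρ ≤ |k − j|`, `ρ^{10} = T² + |j| + |k|`, `1 ≤ ρ`,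
`log₊(|j| + |k|) ≤ 10 log ρ`, and every `R ≥ 0` with `R^{10} ≤ T²` satisfies `R ≤ ρ`.
[cite: RodgersTaoFMP2020, §1.2 p. 7 (definition of `∼_T`)] -/
theorem nonNearby_radius {T : ℝ} (hT : 3 ≤ T) {j k : ℤ} (hjk : j ≠ k) (hnn : ¬ Nearby T j k) :
    (T ^ 2 + |(j : ℝ)| + |(k : ℝ)|) ^ (1 / 10 : ℝ) ≤ |(k : ℝ) - j| ∧
    ((T ^ 2 + |(j : ℝ)| + |(k : ℝ)|) ^ (1 / 10 : ℝ)) ^ 10 = T ^ 2 + |(j : ℝ)| + |(k : ℝ)| ∧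
    1 ≤ (T ^ 2 + |(j : ℝ)| + |(k : ℝ)|) ^ (1 / 10 : ℝ) ∧
    logPlus (|(j : ℝ)| + |(k : ℝ)|) ≤
      10 * Real.log ((T ^ 2 + |(j : ℝ)| + |(k : ℝ)|) ^ (1 / 10 : ℝ)) ∧
    ∀ R : ℝ, 0 ≤ R → R ^ 10 ≤ T ^ 2 → R ≤ (T ^ 2 + |(j : ℝ)| + |(k : ℝ)|) ^ (1 / 10 : ℝ) := by
  set N : ℝ := T ^ 2 + |(j : ℝ)| + |(k : ℝ)| with hN
  set ρ : ℝ := N ^ (1 / 10 : ℝ) with hρ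
  have hT2 : 9 ≤ T ^ 2 := by nlinarith
  have hj0 : 0 ≤ |(j : ℝ)| := abs_nonneg _
  have hk0 : 0 ≤ |(k : ℝ)| := abs_nonneg _
  have hN0 : 0 ≤ N := by rw [hN]; positivity
  have hTN : T ^ 2 ≤ N := by rw [hN]; linarith
  have hN1 : 1 ≤ N := by linarith
  have hρ10 : ρ ^ 10 = N := rpow_tenth_pow_ten hN0
  have hρ1 : 1 ≤ ρ := Real.one_le_rpow hN1 (by norm_num)
  have hρ0 : 0 < ρ := by linarith
  have hdist : ρ ≤ |(k : ℝ) - j| := by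
    have h : ¬ (|(j : ℝ) - k| < ρ) := fun hlt ↦ hnn ⟨hjk, hlt⟩
    rw [abs_sub_comm]
    exact not_lt.1 h
  have hlog : logPlus (|(j : ℝ)| + |(k : ℝ)|) ≤ 10 * Real.log ρ := by
    have e : Real.log (ρ ^ 10) = 10 * Real.log ρ := by rw [Real.log_pow]; norm_num
    rw [logPlus_eq, abs_of_nonneg (by positivity), ← e, hρ10]
    exact Real.log_le_log (by positivity) (by rw [hN]; linarith)
  refine ⟨hdist, hρ10, hρ1, hlog, fun R hR hRT ↦ ?_⟩
  by_contra hlt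
  rw [not_le] at hlt
  have h1 : ρ ^ 10 < R ^ 10 := pow_lt_pow_left₀ hlt hρ0.le (by norm_num)
  rw [hρ10] at h1
  linarith

/-! ### §2 The termwise bound on a non-nearby pair -/

/-- The constants of (44) and (43) used below (tree theorems
`exists_inv_abs_sub_classicalLocationZ_le`, `RodgersTaoTruncEnergyExpansion.exists_constants`):
`1/|ξ_j − ξ_k| ≤ C₄₄ log₊(|j|+|k|)/|j − k|` on `ℤ*`, and `c₈ log₊ y ≤ log₊ ξ_y ≤ C₈ log₊ y` for real
`y ≥ 1`. [cite: RodgersTaoFMP2020, Lemma 8 (43)–(44) p. 21] -/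
theorem exists_constants :
    ∃ C₄₄ C₈ c₈ : ℝ, 0 < C₄₄ ∧ 0 ≤ C₈ ∧
      (∀ j k : ℤ, j ≠ 0 → k ≠ 0 →
        1 / |classicalLocationZ j - classicalLocationZ k| ≤
          C₄₄ * (logPlus (|(j : ℝ)| + |(k : ℝ)|) / |(j : ℝ) - k|)) ∧
      (∀ y : ℝ, 1 ≤ y → c₈ * logPlus y ≤ logPlus (classicalLocation y) ∧
        logPlus (classicalLocation y) ≤ C₈ * logPlus y) := by
  obtain ⟨C₄₄, hC₄₄, h44⟩ := exists_inv_abs_sub_classicalLocationZ_le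
  obtain ⟨c, C, B, c₈, C₈, A, -, -, -, hc₈, hc₈C₈, -, -, -, h8, -⟩ :=
    RodgersTaoTruncEnergyExpansion.exists_constants
  exact ⟨C₄₄, C₈, c₈, hC₄₄, le_trans hc₈.le hc₈C₈, h44, h8⟩

/-- **«From (43), (44) we have `1/(x_k − x_j)² − 1/(ξ_k − ξ_j)² ≲ log₊^{O(1)}(|j|+|k|)/|k − j|³`
when `j ≠ k` and `j ≁_T k`», made explicit and termwise.** At a time `t` at which the zeros obey
the (50)-shape law `|x_n(t) − ξ_n| ≤ B log₊ ξ_n` (`n ≥ 1`), for `T ≥ 3` and a non-nearby pair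
`j ≠ k` in `ℤ*` whose radius `ρ = (T² + |j| + |k|)^{1/10}` satisfies
`400 · max(B,0) · C₈ · C₄₄ · log² ρ ≤ ρ` (`C₄₄`, `C₈` the constants of (44), (43)):
(i) the pair is COMPARABLE, `|(x_k − x_j) − (ξ_k − ξ_j)| ≤ |ξ_k − ξ_j|/2`; (ii)
`|E_{jk}(t) − 1/(ξ_k − ξ_j)²| ≤ 20 · max(B,0) · C₈ · C₄₄³ · log₊⁴(|j|+|k|)/|k − j|³`. No hypothesis
on `Λ` and no real-rootedness is needed (only the location law at `t`).
[cite: RodgersTaoFMP2020, Prop. 22 proof p. 52 (sentence after (82)); Lemma 8 (43)–(44) p. 21; Cor. 10 (50) p. 23] -/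
theorem abs_interactionEnergy_sub_inv_sq_le {C₄₄ C₈ c₈ : ℝ} (hC₄₄ : 0 < C₄₄) (hC₈ : 0 ≤ C₈)
    (h44 : ∀ j k : ℤ, j ≠ 0 → k ≠ 0 →
      1 / |classicalLocationZ j - classicalLocationZ k| ≤
        C₄₄ * (logPlus (|(j : ℝ)| + |(k : ℝ)|) / |(j : ℝ) - k|))
    (h8 : ∀ y : ℝ, 1 ≤ y → c₈ * logPlus y ≤ logPlus (classicalLocation y) ∧
      logPlus (classicalLocation y) ≤ C₈ * logPlus y)
    {T B t : ℝ} (hT : 3 ≤ T)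
    (h50 : ∀ n : ℕ, 1 ≤ n →
      |deBruijnZero t n - classicalLocation (n : ℝ)| ≤ B * logPlus (classicalLocation (n : ℝ)))
    {j k : ℤ} (hj : j ≠ 0) (hk : k ≠ 0) (hjk : j ≠ k) (hnn : ¬ Nearby T j k)
    (hρ : 400 * (max B 0 * C₈ * C₄₄) *
      Real.log ((T ^ 2 + |(j : ℝ)| + |(k : ℝ)|) ^ (1 / 10 : ℝ)) ^ 2 ≤
        (T ^ 2 + |(j : ℝ)| + |(k : ℝ)|) ^ (1 / 10 : ℝ)) :
    |(deBruijnZeroZ t k - deBruijnZeroZ t j) - (classicalLocationZ k - classicalLocationZ j)| ≤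
        |classicalLocationZ k - classicalLocationZ j| / 2 ∧
    |interactionEnergy t j k - 1 / (classicalLocationZ k - classicalLocationZ j) ^ 2| ≤
        20 * (max B 0 * C₈ * C₄₄ ^ 3) * logPlus (|(j : ℝ)| + |(k : ℝ)|) ^ 4 /
          |(k : ℝ) - j| ^ 3 := by
  obtain ⟨hdist, -, hρ1, hlog, -⟩ := nonNearby_radius hT hjk hnn
  set ρ : ℝ := (T ^ 2 + |(j : ℝ)| + |(k : ℝ)|) ^ (1 / 10 : ℝ) with hρdef
  set B' : ℝ := max B 0 with hB'
  set L : ℝ := logPlus (|(j : ℝ)| + |(k : ℝ)|) with hL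
  have hB'0 : 0 ≤ B' := le_max_right _ _
  have hL0 : 0 < L := logPlus_pos _
  have hd0 : 0 < |(k : ℝ) - j| := lt_of_lt_of_le (by linarith) hdist
  have hΔξ0 : classicalLocationZ k - classicalLocationZ j ≠ 0 := classicalLocationZ_sub_ne_zero hjk
  have hΔξpos : 0 < |classicalLocationZ k - classicalLocationZ j| := abs_pos.2 hΔξ0
  -- the deviations `x_n − ξ_n`, (50) + (43)
  have hdevk := RodgersTaoTruncEnergyExpansion.abs_deviation_le h8 h50 k
  have hdevj := RodgersTaoTruncEnergyExpansion.abs_deviation_le h8 h50 j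
  have hLj : logPlus (j : ℝ) ≤ L :=
    logPlus_mono (by rw [abs_of_nonneg (by positivity : (0 : ℝ) ≤ |(j : ℝ)| + |(k : ℝ)|)]; linarith [abs_nonneg (k : ℝ)])
  have hLk : logPlus (k : ℝ) ≤ L :=
    logPlus_mono (by rw [abs_of_nonneg (by positivity : (0 : ℝ) ≤ |(j : ℝ)| + |(k : ℝ)|)]; linarith [abs_nonneg (j : ℝ)])
  have hdev : |(deBruijnZeroZ t k - deBruijnZeroZ t j) - (classicalLocationZ k - classicalLocationZ j)|
      ≤ 2 * B' * C₈ * L := by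
    have e : (deBruijnZeroZ t k - deBruijnZeroZ t j) - (classicalLocationZ k - classicalLocationZ j) =
        (deBruijnZeroZ t k - classicalLocationZ k) - (deBruijnZeroZ t j - classicalLocationZ j) := by
      ring
    rw [e]
    refine (abs_sub _ _).trans ?_
    have h1 : |deBruijnZeroZ t k - classicalLocationZ k| ≤ B' * C₈ * L :=
      hdevk.trans (mul_le_mul_of_nonneg_left hLk (by positivity))
    have h2 : |deBruijnZeroZ t j - classicalLocationZ j| ≤ B' * C₈ * L :=
      hdevj.trans (mul_le_mul_of_nonneg_left hLj (by positivity))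
    linarith
  -- (44): `1/|ξ_k − ξ_j| ≤ C₄₄ L/|k − j|`
  have h44' : 1 / |classicalLocationZ k - classicalLocationZ j| ≤ C₄₄ * L / |(k : ℝ) - j| := by
    have := h44 j k hj hk
    rw [abs_sub_comm (classicalLocationZ j), abs_sub_comm ((j : ℝ))] at this
    simpa only [hL, mul_div_assoc] using this
  have hΔξ_lower : |(k : ℝ) - j| / (C₄₄ * L) ≤ |classicalLocationZ k - classicalLocationZ j| := by
    have hCL : 0 < C₄₄ * L := by positivity
    rw [div_le_iff₀ hCL]
    have h := h44'
    rw [div_le_div_iff₀ hΔξpos hd0, one_mul] at h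
    linarith
  -- comparability
  have hcomp : 2 * B' * C₈ * L ≤ |classicalLocationZ k - classicalLocationZ j| / 2 := by
    have h1 : 4 * (B' * C₈ * C₄₄) * L ^ 2 ≤ 400 * (B' * C₈ * C₄₄) * Real.log ρ ^ 2 := by
      have hsq : L ^ 2 ≤ (10 * Real.log ρ) ^ 2 := pow_le_pow_left₀ hL0.le hlog 2
      have h0 : 0 ≤ B' * C₈ * C₄₄ := by positivity
      nlinarith
    have h2 : 4 * (B' * C₈ * C₄₄) * L ^ 2 ≤ |(k : ℝ) - j| := h1.trans (hρ.trans hdist)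
    have h3 : 2 * B' * C₈ * L ≤ |(k : ℝ) - j| / (C₄₄ * L) / 2 := by
      rw [div_div, le_div_iff₀ (by positivity)]
      calc 2 * B' * C₈ * L * (C₄₄ * L * 2) = 4 * (B' * C₈ * C₄₄) * L ^ 2 := by ring
        _ ≤ |(k : ℝ) - j| := h2
    exact h3.trans (by linarith [hΔξ_lower])
  refine ⟨hdev.trans hcomp, ?_⟩
  -- the energy difference
  have hE : interactionEnergy t j k = 1 / (deBruijnZeroZ t k - deBruijnZeroZ t j) ^ 2 := by
    rw [interactionEnergy_eq]
    congr 1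
    ring
  rw [hE]
  refine (abs_inv_sq_sub_inv_sq_le hdev hcomp hΔξ0).trans ?_
  have h3 : 1 / |classicalLocationZ k - classicalLocationZ j| ^ 3 ≤ (C₄₄ * L / |(k : ℝ) - j|) ^ 3 := by
    rw [← one_div_pow]
    exact pow_le_pow_left₀ (by positivity) h44' 3
  calc 10 * (2 * B' * C₈ * L) / |classicalLocationZ k - classicalLocationZ j| ^ 3
      = 10 * (2 * B' * C₈ * L) * (1 / |classicalLocationZ k - classicalLocationZ j| ^ 3) := by ring
    _ ≤ 10 * (2 * B' * C₈ * L) * (C₄₄ * L / |(k : ℝ) - j|) ^ 3 :=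
        mul_le_mul_of_nonneg_left h3 (by positivity)
    _ = 20 * (B' * C₈ * C₄₄ ^ 3) * L ^ 4 / |(k : ℝ) - j| ^ 3 := by
        field_simp
        ring

/-- **Non-nearby pairs are comparable** (threshold form in `T`): there is an absolute `K ≥ 0`
such that for every `B` there is `T₀ ≥ 3` with: for all `T ≥ T₀`, every time `t` with the (50)-law
(constant `B`), and every non-nearby pair `j ≠ k` in `ℤ*`,
`|(x_k − x_j) − (ξ_k − ξ_j)| ≤ |ξ_k − ξ_j|/2` and
`|E_{jk}(t) − 1/(ξ_k − ξ_j)²| ≤ K · max(B,0) · log₊⁴(|j|+|k|)/|k − j|³`, and moreover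
`T^{1/5} ≤ |k − j|` in the form «`R ≤ |k − j|` whenever `R ≥ 0`, `R^{10} ≤ T²`».
[cite: RodgersTaoFMP2020, Prop. 22 proof p. 52 (sentence after (82)); Lemma 8 (43)–(44) p. 21; Cor. 10 (50) p. 23] -/
theorem nonNearby_comparable :
    ∃ K : ℝ, 0 ≤ K ∧ ∀ B : ℝ, ∃ T₀ : ℝ, 3 ≤ T₀ ∧ ∀ T t : ℝ, T₀ ≤ T →
      (∀ n : ℕ, 1 ≤ n →
        |deBruijnZero t n - classicalLocation (n : ℝ)| ≤ B * logPlus (classicalLocation (n : ℝ))) →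
      ∀ j k : ℤ, j ≠ 0 → k ≠ 0 → j ≠ k → ¬ Nearby T j k →
        |(deBruijnZeroZ t k - deBruijnZeroZ t j) - (classicalLocationZ k - classicalLocationZ j)| ≤
            |classicalLocationZ k - classicalLocationZ j| / 2 ∧
        |interactionEnergy t j k - 1 / (classicalLocationZ k - classicalLocationZ j) ^ 2| ≤
            K * max B 0 * logPlus (|(j : ℝ)| + |(k : ℝ)|) ^ 4 / |(k : ℝ) - j| ^ 3 ∧
        ∀ R : ℝ, 0 ≤ R → R ^ 10 ≤ T ^ 2 → R ≤ |(k : ℝ) - j| := by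
  obtain ⟨C₄₄, C₈, c₈, hC₄₄, hC₈, h44, h8⟩ := exists_constants
  refine ⟨20 * (C₈ * C₄₄ ^ 3), by positivity, fun B ↦ ?_⟩
  obtain ⟨R₀, hR₀1, hR₀⟩ := exists_mul_log_pow_le (400 * (max B 0 * C₈ * C₄₄)) 2
  refine ⟨max 3 (R₀ ^ 5), le_max_left _ _, fun T t hT h50 j k hj hk hjk hnn ↦ ?_⟩
  have hT3 : 3 ≤ T := le_trans (le_max_left _ _) hT
  obtain ⟨hdist, -, -, -, hR⟩ := nonNearby_radius hT3 hjk hnn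
  have hR₀T : R₀ ^ 10 ≤ T ^ 2 := by
    have h5 : R₀ ^ 5 ≤ T := le_trans (le_max_right _ _) hT
    calc R₀ ^ 10 = (R₀ ^ 5) ^ 2 := by ring
      _ ≤ T ^ 2 := pow_le_pow_left₀ (by positivity) h5 2
  have hρ := hR₀ _ (hR R₀ (by linarith) hR₀T)
  obtain ⟨hcmp, hterm⟩ := abs_interactionEnergy_sub_inv_sq_le hC₄₄ hC₈ h44 h8 hT3 h50 hj hk hjk hnn hρ
  refine ⟨hcmp, hterm.trans_eq (by ring), fun R hR0 hRT ↦ (hR R hR0 hRT).trans hdist⟩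

/-! ### §3 «So the final term in (82) is negligible» -/

set_option maxHeartbeats 400000 in
/-- **The non-nearby remainder of (82) is negligible.** For every `B` and `ε > 0` there is
`T₁ ≥ 3` (depending on `B`, `ε` only) such that for all `T ≥ T₁` and every time `t` at which the
zeros obey the (50)-shape law with constant `B`, the family
`p = (j,k) ↦ 𝟙[j ≁_T k] · ψ_T(j)ψ_T(k)(E_{jk}(t) − 1/(ξ_k − ξ_j)²)` on the pairs `j ≠ k` of `ℤ*` is
summable — no finiteness hypothesis on `Ẽ_T(t)` — and
`|Σ'_{j ≠ k, j ≁_T k} ψ_T(j)ψ_T(k)(E_{jk}(t) − 1/(ξ_k − ξ_j)²)| ≤ ε · T log³ T`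
(the printed «negligible» `= o_{T→∞}(T log³ T + Ẽ_T)`, here without the `Ẽ_T` term and with the rate
uniform in `t`). Road: termwise `abs_interactionEnergy_sub_inv_sq_le`, then
`log₊⁴(|j|+|k|)/|k − j|³ ≤ 10⁴ (log⁴ ρ/ρ)/(k − j)² ≤ 10⁴ η/(k − j)²` for `T` large, and
`Σ_{(j,k)} ψ_T(j)/(k − j)² = (Σ_j ψ_T(j))(Σ_d 1/d²) ≤ 10 T log T · S₂` ((66)).
[cite: RodgersTaoFMP2020, Prop. 22 proof p. 52 («so the final term in (82) is negligible»; v5 `mang`); (66) p. 42] -/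
theorem abs_tsum_nonNearby_le (B ε : ℝ) (hε : 0 < ε) :
    ∃ T₁ : ℝ, 3 ≤ T₁ ∧ ∀ T t : ℝ, T₁ ≤ T →
      (∀ n : ℕ, 1 ≤ n →
        |deBruijnZero t n - classicalLocation (n : ℝ)| ≤ B * logPlus (classicalLocation (n : ℝ))) →
      Summable (fun p : zstarOffDiag ↦ if Nearby T p.1.1 p.1.2 then (0 : ℝ) else
        truncWeight T p.1.1 * truncWeight T p.1.2 *
          (interactionEnergy t p.1.1 p.1.2 -
            1 / (classicalLocationZ p.1.2 - classicalLocationZ p.1.1) ^ 2)) ∧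
      |∑' p : zstarOffDiag, (if Nearby T p.1.1 p.1.2 then (0 : ℝ) else
        truncWeight T p.1.1 * truncWeight T p.1.2 *
          (interactionEnergy t p.1.1 p.1.2 -
            1 / (classicalLocationZ p.1.2 - classicalLocationZ p.1.1) ^ 2))|
        ≤ ε * (T * Real.log T ^ 3) := by
  obtain ⟨C₄₄, C₈, c₈, hC₄₄, hC₈, h44, h8⟩ := exists_constants
  set B' : ℝ := max B 0 with hB'
  have hB'0 : 0 ≤ B' := le_max_right _ _
  set K₀ : ℝ := 20 * (B' * C₈ * C₄₄ ^ 3) * 10 ^ 4 with hK₀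
  have hK₀0 : 0 ≤ K₀ := by positivity
  -- `S₂ = Σ_{d ∈ ℤ} 1/d²`
  have hS₂s : Summable (fun d : ℤ ↦ 1 / (d : ℝ) ^ 2) :=
    Real.summable_one_div_int_pow.mpr one_lt_two
  set S₂ : ℝ := ∑' d : ℤ, 1 / (d : ℝ) ^ 2 with hS₂
  have hS₂0 : 0 ≤ S₂ := tsum_nonneg fun d ↦ by positivity
  set η : ℝ := ε / (K₀ * 10 * S₂ + 1) with hη
  have hη0 : 0 < η := by positivity
  obtain ⟨R₀, hR₀1, hR₀⟩ := exists_mul_log_pow_le (400 * (B' * C₈ * C₄₄)) 2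
  obtain ⟨R₁, hR₁1, hR₁⟩ := exists_mul_log_pow_le (1 / η) 4
  refine ⟨max 3 (max (R₀ ^ 5) (R₁ ^ 5)), le_max_left _ _, fun T t hT h50 ↦ ?_⟩
  have hT3 : 3 ≤ T := le_trans (le_max_left _ _) hT
  obtain ⟨hlogT, hTL0⟩ := one_le_log_of_three_le' hT3
  have hT0 : 0 < T := by linarith
  have hpow10 : ∀ R : ℝ, 1 ≤ R → R ^ 5 ≤ T → R ^ 10 ≤ T ^ 2 := fun R hR h5 ↦ by
    calc R ^ 10 = (R ^ 5) ^ 2 := by ring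
      _ ≤ T ^ 2 := pow_le_pow_left₀ (by positivity) h5 2
  have hR₀T : R₀ ^ 10 ≤ T ^ 2 :=
    hpow10 R₀ hR₀1 (le_trans (le_trans (le_max_left _ _) (le_max_right _ _)) hT)
  have hR₁T : R₁ ^ 10 ≤ T ^ 2 :=
    hpow10 R₁ hR₁1 (le_trans (le_trans (le_max_right _ _) (le_max_right _ _)) hT)
  -- the family and its majorant on `ℤ × ℤ`
  set F : zstarOffDiag → ℝ := fun p ↦ if Nearby T p.1.1 p.1.2 then (0 : ℝ) else
    truncWeight T p.1.1 * truncWeight T p.1.2 *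
      (interactionEnergy t p.1.1 p.1.2 -
        1 / (classicalLocationZ p.1.2 - classicalLocationZ p.1.1) ^ 2) with hF
  set M : ℤ × ℤ → ℝ := fun q ↦ K₀ * η * (truncWeight T q.1 * (1 / ((q.2 : ℝ) - q.1) ^ 2)) with hM
  have hM0 : ∀ q, 0 ≤ M q := fun q ↦ by
    have := truncWeight_pos hTL0 q.1
    positivity
  -- termwise domination `|F p| ≤ M p`
  have hFM : ∀ p : zstarOffDiag, |F p| ≤ M p.1 := by
    intro p
    obtain ⟨hj, hk, hjk⟩ := mem_zstarOffDiag.1 p.2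
    by_cases hnb : Nearby T p.1.1 p.1.2
    · have h0 : F p = 0 := by simp only [hF, if_pos hnb]
      rw [h0, abs_zero]
      exact hM0 _
    · have hFp : F p = truncWeight T p.1.1 * truncWeight T p.1.2 *
          (interactionEnergy t p.1.1 p.1.2 -
            1 / (classicalLocationZ p.1.2 - classicalLocationZ p.1.1) ^ 2) := by
        simp only [hF, if_neg hnb]
      obtain ⟨hdist, -, hρ1, hlog, hR⟩ := nonNearby_radius hT3 hjk hnb
      set ρ : ℝ := (T ^ 2 + |(p.1.1 : ℝ)| + |(p.1.2 : ℝ)|) ^ (1 / 10 : ℝ) with hρdef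
      have hρ0 : 0 < ρ := by linarith
      have hρR₀ : R₀ ≤ ρ := hR R₀ (by linarith) hR₀T
      have hρR₁ : R₁ ≤ ρ := hR R₁ (by linarith) hR₁T
      have hcmp : 400 * (B' * C₈ * C₄₄) * Real.log ρ ^ 2 ≤ ρ := hR₀ ρ hρR₀
      obtain ⟨-, hterm⟩ :=
        abs_interactionEnergy_sub_inv_sq_le hC₄₄ hC₈ h44 h8 hT3 h50 hj hk hjk hnb hcmp
      have hgain : Real.log ρ ^ 4 ≤ η * ρ := by
        have h := hR₁ ρ hρR₁
        rwa [one_div, inv_mul_le_iff₀ hη0] at h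
      set L : ℝ := logPlus (|(p.1.1 : ℝ)| + |(p.1.2 : ℝ)|) with hL
      set d : ℝ := (p.1.2 : ℝ) - p.1.1 with hd
      have hd0 : 0 < |d| := lt_of_lt_of_le hρ0 hdist
      have hL0 : 0 ≤ L := logPlus_nonneg _
      have hL4 : L ^ 4 ≤ 10 ^ 4 * (η * ρ) := by
        calc L ^ 4 ≤ (10 * Real.log ρ) ^ 4 := pow_le_pow_left₀ hL0 hlog 4
          _ = 10 ^ 4 * Real.log ρ ^ 4 := by ring
          _ ≤ 10 ^ 4 * (η * ρ) := mul_le_mul_of_nonneg_left hgain (by norm_num)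
      have hρd : ρ / |d| ^ 3 ≤ 1 / d ^ 2 := by
        rw [← sq_abs d, div_le_div_iff₀ (pow_pos hd0 3) (pow_pos hd0 2), one_mul]
        calc ρ * |d| ^ 2 ≤ |d| * |d| ^ 2 := mul_le_mul_of_nonneg_right hdist (by positivity)
          _ = |d| ^ 3 := by ring
      have hψk : truncWeight T p.1.2 ≤ 1 := truncWeight_le_one hTL0 _
      have hψj0 : 0 ≤ truncWeight T p.1.1 := (truncWeight_pos hTL0 _).le
      have hψk0 : 0 ≤ truncWeight T p.1.2 := (truncWeight_pos hTL0 _).le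
      have hE : |interactionEnergy t p.1.1 p.1.2 -
          1 / (classicalLocationZ p.1.2 - classicalLocationZ p.1.1) ^ 2| ≤ K₀ * η * (1 / d ^ 2) := by
        calc |interactionEnergy t p.1.1 p.1.2 -
              1 / (classicalLocationZ p.1.2 - classicalLocationZ p.1.1) ^ 2|
            ≤ 20 * (B' * C₈ * C₄₄ ^ 3) * L ^ 4 / |d| ^ 3 := hterm
          _ ≤ 20 * (B' * C₈ * C₄₄ ^ 3) * (10 ^ 4 * (η * ρ)) / |d| ^ 3 :=
              div_le_div_of_nonneg_right (mul_le_mul_of_nonneg_left hL4 (by positivity))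
                (pow_pos hd0 3).le
          _ = K₀ * η * (ρ / |d| ^ 3) := by simp only [hK₀]; ring
          _ ≤ K₀ * η * (1 / d ^ 2) := mul_le_mul_of_nonneg_left hρd (by positivity)
      rw [hFp, abs_mul, abs_mul, abs_of_nonneg hψj0, abs_of_nonneg hψk0]
      have step1 : truncWeight T p.1.1 * truncWeight T p.1.2 ≤ truncWeight T p.1.1 * 1 :=
        mul_le_mul_of_nonneg_left hψk hψj0
      calc truncWeight T p.1.1 * truncWeight T p.1.2 *
            |interactionEnergy t p.1.1 p.1.2 -
              1 / (classicalLocationZ p.1.2 - classicalLocationZ p.1.1) ^ 2|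
          ≤ truncWeight T p.1.1 * 1 * (K₀ * η * (1 / d ^ 2)) :=
            mul_le_mul step1 hE (abs_nonneg _) (mul_nonneg hψj0 zero_le_one)
        _ = M p.1 := by simp only [hM, hd]; ring
  -- the majorant is summable on `ℤ × ℤ`: shear `(j,k) ↦ (j, k − j)` and (66)
  obtain ⟨hψS, hψle⟩ :=
    RodgersTaoTruncEnergyExpansion.tsum_truncWeight_mul_logPlus_pow_le hT3 (p := 0) (by norm_num)
  have hψS' : Summable (fun j : ℤ ↦ truncWeight T j) := by simpa using hψS
  have hψle' : ∑' j : ℤ, truncWeight T j ≤ 10 * (T * Real.log T) := by simpa using hψle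
  have hψ0 : ∀ j : ℤ, 0 ≤ truncWeight T j := fun j ↦ (truncWeight_pos hTL0 j).le
  have hPS : Summable (fun x : ℤ × ℤ ↦ truncWeight T x.1 * (1 / (x.2 : ℝ) ^ 2)) :=
    hψS'.mul_of_nonneg hS₂s hψ0 (fun d ↦ by positivity)
  set e : ℤ × ℤ ≃ ℤ × ℤ := Equiv.prodShear (Equiv.refl ℤ) (fun j ↦ Equiv.addLeft (-j)) with he
  have heP : ∀ q : ℤ × ℤ, (fun x : ℤ × ℤ ↦ truncWeight T x.1 * (1 / (x.2 : ℝ) ^ 2)) (e q) =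
      truncWeight T q.1 * (1 / ((q.2 : ℝ) - q.1) ^ 2) := by
    intro q
    obtain ⟨j, k⟩ := q
    simp only [he, Equiv.prodShear_apply, Equiv.refl_apply, Equiv.coe_addLeft]
    push_cast
    ring
  have hMP : M = fun q ↦ K₀ * η *
      ((fun x : ℤ × ℤ ↦ truncWeight T x.1 * (1 / (x.2 : ℝ) ^ 2)) (e q)) := by
    funext q
    rw [heP]
  have hPeS : Summable (fun q : ℤ × ℤ ↦
      (fun x : ℤ × ℤ ↦ truncWeight T x.1 * (1 / (x.2 : ℝ) ^ 2)) (e q)) :=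
    (e.summable_iff (f := fun x : ℤ × ℤ ↦ truncWeight T x.1 * (1 / (x.2 : ℝ) ^ 2))).2 hPS
  have hMS : Summable M := by
    rw [hMP]
    exact hPeS.mul_left _
  have hMtsum : ∑' q, M q = K₀ * η * ((∑' j : ℤ, truncWeight T j) * S₂) := by
    rw [hMP, tsum_mul_left]
    congr 1
    rw [e.tsum_eq (fun x : ℤ × ℤ ↦ truncWeight T x.1 * (1 / (x.2 : ℝ) ^ 2)), hS₂]
    exact (hψS'.tsum_mul_tsum hS₂s hPS).symm
  -- conclusion
  have hMsub : Summable (fun p : zstarOffDiag ↦ M p.1) := hMS.subtype _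
  have hFabsS : Summable (fun p : zstarOffDiag ↦ |F p|) :=
    Summable.of_nonneg_of_le (fun p ↦ abs_nonneg _) hFM hMsub
  have hFS : Summable F := hFabsS.of_abs
  refine ⟨hFS, ?_⟩
  have h1 : |∑' p, F p| ≤ ∑' p, |F p| := by
    have hn : Summable (fun p ↦ ‖F p‖) := by simpa only [Real.norm_eq_abs] using hFabsS
    have := norm_tsum_le_tsum_norm hn
    simpa only [Real.norm_eq_abs] using this
  have h2 : ∑' p : zstarOffDiag, |F p| ≤ ∑' p : zstarOffDiag, M p.1 :=
    hFabsS.tsum_le_tsum hFM hMsub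
  have h3 : ∑' p : zstarOffDiag, M p.1 ≤ ∑' q, M q := hMS.tsum_subtype_le M zstarOffDiag hM0
  have h4 : ∑' q, M q ≤ ε * (T * Real.log T) := by
    rw [hMtsum]
    have hb : 0 < K₀ * 10 * S₂ + 1 := by positivity
    have hcoef : K₀ * 10 * S₂ * η ≤ ε := by
      rw [hη, ← mul_div_assoc, div_le_iff₀ hb]
      nlinarith [hε.le, hK₀0, hS₂0]
    calc K₀ * η * ((∑' j : ℤ, truncWeight T j) * S₂)
        ≤ K₀ * η * (10 * (T * Real.log T) * S₂) :=
          mul_le_mul_of_nonneg_left (mul_le_mul_of_nonneg_right hψle' hS₂0) (by positivity)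
      _ = K₀ * 10 * S₂ * η * (T * Real.log T) := by ring
      _ ≤ ε * (T * Real.log T) := mul_le_mul_of_nonneg_right hcoef hTL0.le
  have h5 : ε * (T * Real.log T) ≤ ε * (T * Real.log T ^ 3) := by
    have hl : Real.log T * 1 ≤ Real.log T * Real.log T ^ 2 :=
      mul_le_mul_of_nonneg_left (one_le_pow₀ hlogT) (by linarith)
    have : T * Real.log T ≤ T * Real.log T ^ 3 := by
      calc T * Real.log T = T * (Real.log T * 1) := by ring
        _ ≤ T * (Real.log T * Real.log T ^ 2) := mul_le_mul_of_nonneg_left hl hT0.le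
        _ = T * Real.log T ^ 3 := by ring
    exact mul_le_mul_of_nonneg_left this hε.le
  exact h1.trans (h2.trans (h3.trans (h4.trans h5)))

/-! ### §4 Display (82): `Ẽ_T = X₁ − X′₁ + negligible` -/

/-- Splitting an off-diagonal family at the nearby pairs: for any `G : ℤ × ℤ → ℝ`, the family
`p ↦ 𝟙[j ∼_T k] G(p)` on the pairs `j ≠ k` of `ℤ*` is summable iff `G` is summable on the nearby
pairs, and the two sums agree (both are the `ℤ × ℤ`-sum of `𝟙_{nearbyPairs T} G`, nearby pairs
being off-diagonal). [cite: RodgersTaoFMP2020, §1.2 p. 7 (definition of `∼_T`); §7 p. 43 (69)] -/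
theorem summable_nearby_part_iff (T : ℝ) (G : ℤ × ℤ → ℝ) :
    (Summable (fun p : zstarOffDiag ↦ if Nearby T p.1.1 p.1.2 then G p.1 else 0) ↔
      Summable (fun p : nearbyPairs T ↦ G p.1)) ∧
    ∑' p : zstarOffDiag, (if Nearby T p.1.1 p.1.2 then G p.1 else 0) =
      ∑' p : nearbyPairs T, G p.1 := by
  have hpt : ∀ p : zstarOffDiag, (if Nearby T p.1.1 p.1.2 then G p.1 else 0) =
      (nearbyPairs T).indicator G p.1 := by
    intro p
    obtain ⟨hj, hk, -⟩ := mem_zstarOffDiag.1 p.2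
    by_cases h : Nearby T p.1.1 p.1.2
    · rw [if_pos h, Set.indicator_of_mem (show p.1 ∈ nearbyPairs T from ⟨hj, hk, h⟩)]
    · rw [if_neg h, Set.indicator_of_notMem (fun hm : p.1 ∈ nearbyPairs T ↦ h hm.2.2)]
  have hsupp : Function.support ((nearbyPairs T).indicator G) ⊆ zstarOffDiag := by
    intro q hq
    have hq' : q ∈ nearbyPairs T := by
      by_contra h
      exact hq (Set.indicator_of_notMem h G)
    exact nearbyPairs_subset_zstarOffDiag T hq'
  have hfun : (fun p : zstarOffDiag ↦ if Nearby T p.1.1 p.1.2 then G p.1 else 0) =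
      ((nearbyPairs T).indicator G) ∘ ((↑) : zstarOffDiag → ℤ × ℤ) := funext hpt
  constructor
  · rw [hfun, summable_subtype_iff_indicator, Set.indicator_indicator,
      Set.inter_eq_right.2 (nearbyPairs_subset_zstarOffDiag T), ← summable_subtype_iff_indicator]
    exact Iff.rfl
  · calc ∑' p : zstarOffDiag, (if Nearby T p.1.1 p.1.2 then G p.1 else 0)
        = ∑' p : zstarOffDiag, (nearbyPairs T).indicator G p.1 := tsum_congr hpt
      _ = ∑' q : ℤ × ℤ, (nearbyPairs T).indicator G q := tsum_subtype_eq_of_support_subset hsupp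
      _ = ∑' p : nearbyPairs T, G p.1 := (tsum_subtype (nearbyPairs T) G).symm

/-- **Display (82) of the proof of Proposition 22, pointwise in `t` (RH-FREE schema):
`Ẽ_T(t) = X₁(t) − X′₁ + negligible`.** For every `B` and `ε > 0` there is `T₁ ≥ 3` (depending on
`B`, `ε` only) such that for all `T ≥ T₁` and every time `t` lying above a real-rooted time at which
the zeros obey the (50)-shape law `|x_n(t) − ξ_n| ≤ B log₊ ξ_n` (`n ≥ 1`): (i) `X′₁ =
Σ_{j ∼_T k} ψ_T(j)ψ_T(k)/(ξ_k − ξ_j)²` is finite (summable; `t`-free); (ii) `Ẽ_T(t)` is finite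
(`Summable (truncEnergyTerm T t)`) iff `X₁(t) = Σ_{j ∼_T k} ψ_T(j)ψ_T(k) E_{jk}(t)` is; (iii) if so,
`|Ẽ_T(t) − (X₁(t) − X′₁)| ≤ ε · T log³ T`. Road = the printed one: Lemma 18 (schema
`rodgers_tao_truncEnergy_expansion_of`, `Õ(1) = C max(B,0) log⁶ T ≤ (ε/2) T log³ T` for `T` large),
the split of the off-diagonal pairs into nearby and non-nearby ones, and `abs_tsum_nonNearby_le`.
What this shows about the printed Prop. 22 (typed `rodgers_tao_truncHamiltonian_deriv`, range
`Λ/2 ≤ t ≤ 0` under `Λ < 0`, VACUOUS-AS-PRINTED): the energy side of its main-term analysis holds on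
every window where its inputs hold; the derivative side is not touched here.
[cite: RodgersTaoFMP2020, Prop. 22 proof p. 52 (display (82) = v5 `mang`); Lemma 18 p. 42; Lemma 21 proof p. 48 (first display)] -/
theorem truncEnergy_nearby_reduction (B ε : ℝ) (hε : 0 < ε) :
    ∃ T₁ : ℝ, 3 ≤ T₁ ∧ ∀ T t : ℝ, T₁ ≤ T →
      (∃ t₁ : ℝ, t₁ < t ∧ HasOnlyRealZeros (deBruijnH t₁)) →
      (∀ n : ℕ, 1 ≤ n →
        |deBruijnZero t n - classicalLocation (n : ℝ)| ≤ B * logPlus (classicalLocation (n : ℝ))) →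
      Summable (fun p : nearbyPairs T ↦ truncWeight T p.1.1 * truncWeight T p.1.2 /
          (classicalLocationZ p.1.2 - classicalLocationZ p.1.1) ^ 2) ∧
      (Summable (truncEnergyTerm T t) ↔
        Summable (fun p : nearbyPairs T ↦
          truncWeight T p.1.1 * truncWeight T p.1.2 * interactionEnergy t p.1.1 p.1.2)) ∧
      (Summable (truncEnergyTerm T t) →
        |truncEnergy T t -
            (∑' p : nearbyPairs T,
                truncWeight T p.1.1 * truncWeight T p.1.2 * interactionEnergy t p.1.1 p.1.2 -
              ∑' p : nearbyPairs T, truncWeight T p.1.1 * truncWeight T p.1.2 /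
                (classicalLocationZ p.1.2 - classicalLocationZ p.1.1) ^ 2)| ≤
          ε * (T * Real.log T ^ 3)) := by
  obtain ⟨C, hC0, hL18⟩ := rodgers_tao_truncEnergy_expansion_of
  obtain ⟨T₁a, hT₁a3, hA⟩ := abs_tsum_nonNearby_le B (ε / 2) (by positivity)
  obtain ⟨Cξ, Tξ, hξ⟩ := rodgers_tao_truncWeight_xi_sq_sum_bound_holds
  obtain ⟨R₂, hR₂1, hR₂⟩ := exists_mul_log_pow_le (2 * C * max B 0 / ε) 3
  refine ⟨max T₁a (max Tξ R₂), le_trans hT₁a3 (le_max_left _ _), fun T t hT hΛ h50 ↦ ?_⟩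
  have hTa : T₁a ≤ T := le_trans (le_max_left _ _) hT
  have hT3 : 3 ≤ T := le_trans hT₁a3 hTa
  have hTξ : Tξ ≤ T := le_trans (le_trans (le_max_left _ _) (le_max_right _ _)) hT
  have hTR₂ : R₂ ≤ T := le_trans (le_trans (le_max_right _ _) (le_max_right _ _)) hT
  obtain ⟨hlogT, hTL0⟩ := one_le_log_of_three_le' hT3
  have hT0 : 0 < T := by linarith
  obtain ⟨-, -, hiff, hbd⟩ := hL18 B T t hT3 hΛ h50
  obtain ⟨hFS, hFbd⟩ := hA T t hTa h50
  obtain ⟨hXiS, -⟩ := hξ T hTξ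
  -- the main family on `ℤ × ℤ`
  set G : ℤ × ℤ → ℝ := fun q ↦ truncWeight T q.1 * truncWeight T q.2 *
    (interactionEnergy t q.1 q.2 - 1 / (classicalLocationZ q.2 - classicalLocationZ q.1) ^ 2) with hG
  have hsplit : ∀ p : zstarOffDiag, G p.1 =
      (if Nearby T p.1.1 p.1.2 then G p.1 else 0) +
        (if Nearby T p.1.1 p.1.2 then (0 : ℝ) else G p.1) := by
    intro p
    by_cases h : Nearby T p.1.1 p.1.2 <;> simp [h]
  obtain ⟨hNiff, hNtsum⟩ := summable_nearby_part_iff T G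
  have hFS' : Summable (fun p : zstarOffDiag ↦ if Nearby T p.1.1 p.1.2 then (0 : ℝ) else G p.1) :=
    hFS
  -- (i) `X′₁` is finite (`t`-free: the p. 48 display `Σ_{j ≠ k} ψψ/(ξ_j − ξ_k)² ≪ T log³ T`)
  have hXi' : Summable (fun p : nearbyPairs T ↦ truncWeight T p.1.1 * truncWeight T p.1.2 /
      (classicalLocationZ p.1.2 - classicalLocationZ p.1.1) ^ 2) := by
    let ι : nearbyPairs T → zstarOffDiag := fun p ↦ ⟨p.1, nearbyPairs_subset_zstarOffDiag T p.2⟩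
    have hι : Function.Injective ι := fun p q h ↦
      Subtype.ext (congrArg (fun x : zstarOffDiag ↦ x.1) h)
    refine (hXiS.comp_injective hι).congr fun p ↦ ?_
    simp only [Function.comp_apply, ι]
    congr 1
    ring
  -- (ii) on the nearby pairs, `ψψ(E − 1/Δξ²)` is summable iff `ψψ E` is
  have hNE : Summable (fun p : nearbyPairs T ↦ G p.1) ↔
      Summable (fun p : nearbyPairs T ↦ truncWeight T p.1.1 * truncWeight T p.1.2 *
        interactionEnergy t p.1.1 p.1.2) := by
    have e : ∀ p : nearbyPairs T, G p.1 = truncWeight T p.1.1 * truncWeight T p.1.2 *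
        interactionEnergy t p.1.1 p.1.2 - truncWeight T p.1.1 * truncWeight T p.1.2 /
          (classicalLocationZ p.1.2 - classicalLocationZ p.1.1) ^ 2 := fun p ↦ by
      simp only [hG]
      ring
    rw [summable_congr e]
    exact ⟨fun h ↦ by simpa using h.add hXi', fun h ↦ h.sub hXi'⟩
  -- the off-diagonal family is summable iff its nearby part is (the non-nearby part being summable)
  have hMN : Summable (fun p : zstarOffDiag ↦ G p.1) ↔
      Summable (fun p : zstarOffDiag ↦ if Nearby T p.1.1 p.1.2 then G p.1 else 0) := by
    constructor
    · intro h
      refine (h.sub hFS').congr fun p ↦ ?_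
      by_cases hn : Nearby T p.1.1 p.1.2 <;> simp [hn]
    · intro h
      exact (h.add hFS').congr fun p ↦ (hsplit p).symm
  refine ⟨hXi', (hiff.trans hMN).trans (hNiff.trans hNE), fun hsum ↦ ?_⟩
  -- (iii) the bound
  have hmainS : Summable (fun p : zstarOffDiag ↦ G p.1) := hiff.1 hsum
  have hNS : Summable (fun p : zstarOffDiag ↦ if Nearby T p.1.1 p.1.2 then G p.1 else 0) :=
    hMN.1 hmainS
  have hES : Summable (fun p : nearbyPairs T ↦ truncWeight T p.1.1 * truncWeight T p.1.2 *
      interactionEnergy t p.1.1 p.1.2) := hNE.1 (hNiff.1 hNS)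
  have h1 : ∑' p : zstarOffDiag, G p.1 = ∑' p : nearbyPairs T, G p.1 +
      ∑' p : zstarOffDiag, (if Nearby T p.1.1 p.1.2 then (0 : ℝ) else G p.1) := by
    rw [← hNtsum, ← hNS.tsum_add hFS']
    exact tsum_congr hsplit
  have h2 : ∑' p : nearbyPairs T, G p.1 =
      ∑' p : nearbyPairs T,
          truncWeight T p.1.1 * truncWeight T p.1.2 * interactionEnergy t p.1.1 p.1.2 -
        ∑' p : nearbyPairs T, truncWeight T p.1.1 * truncWeight T p.1.2 /
          (classicalLocationZ p.1.2 - classicalLocationZ p.1.1) ^ 2 := by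
    rw [← hES.tsum_sub hXi']
    refine tsum_congr fun p ↦ ?_
    simp only [hG]
    ring
  have hbd' := hbd hsum
  -- `C max(B,0) log⁶ T ≤ (ε/2) T log³ T`
  have hlog6 : C * max B 0 * Real.log T ^ 6 ≤ ε / 2 * (T * Real.log T ^ 3) := by
    have h := hR₂ T hTR₂
    have h' : 2 * C * max B 0 / ε * Real.log T ^ 3 * (ε / 2 * Real.log T ^ 3) ≤
        T * (ε / 2 * Real.log T ^ 3) := mul_le_mul_of_nonneg_right h (by positivity)
    calc C * max B 0 * Real.log T ^ 6
        = 2 * C * max B 0 / ε * Real.log T ^ 3 * (ε / 2 * Real.log T ^ 3) := by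
          field_simp
      _ ≤ T * (ε / 2 * Real.log T ^ 3) := h'
      _ = ε / 2 * (T * Real.log T ^ 3) := by ring
  have hre : truncEnergy T t -
      (∑' p : nearbyPairs T,
          truncWeight T p.1.1 * truncWeight T p.1.2 * interactionEnergy t p.1.1 p.1.2 -
        ∑' p : nearbyPairs T, truncWeight T p.1.1 * truncWeight T p.1.2 /
          (classicalLocationZ p.1.2 - classicalLocationZ p.1.1) ^ 2) =
      (truncEnergy T t - ∑' p : zstarOffDiag, G p.1) +
        ∑' p : zstarOffDiag, (if Nearby T p.1.1 p.1.2 then (0 : ℝ) else G p.1) := by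
    rw [h1, h2]
    ring
  rw [hre]
  calc |(truncEnergy T t - ∑' p : zstarOffDiag, G p.1) +
        ∑' p : zstarOffDiag, (if Nearby T p.1.1 p.1.2 then (0 : ℝ) else G p.1)|
      ≤ |truncEnergy T t - ∑' p : zstarOffDiag, G p.1| +
        |∑' p : zstarOffDiag, (if Nearby T p.1.1 p.1.2 then (0 : ℝ) else G p.1)| := abs_add_le _ _
    _ ≤ C * max B 0 * Real.log T ^ 6 + ε / 2 * (T * Real.log T ^ 3) := add_le_add hbd' hFbd
    _ ≤ ε * (T * Real.log T ^ 3) := by linarith [hlog6]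

end RodgersTaoTruncEnergyNearby

/-! ### §5 The same on the printed range `Λ/2 ≤ t ≤ 0`, from Corollary 10 (50) -/

open RodgersTaoTruncEnergyNearby in
/-- **Display (82) on the printed range** — the as-printed reduction: the typed Corollary 10 (50)
`RodgersTao2020.cor33_location` (location law for `Λ < t ≤ 0`, witness form) implies, for every
real-rooted witness `t₀ < 0` and `ε > 0`, the existence of `T₁` with: for all `T ≥ T₁` and all
`t ∈ [t₀/2, 0]`, `X′₁` is finite, `Ẽ_T(t)` is finite iff `X₁(t)` is, and then
`|Ẽ_T(t) − (X₁(t) − X′₁)| ≤ ε · T log³ T`. Both `cor33_location` and the printed Prop. 22 are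
VACUOUS-AS-PRINTED in the tree (`Λ ≥ 0`); the implication is RH-free content, and fed with
`RodgersTao2020.cor33_location_content` it is a Dobner-free proof term of the printed step. No
`_holds` of anything is declared. [cite: RodgersTaoFMP2020, Prop. 22 proof p. 52 (display (82) = v5 `mang`); Cor. 10 (50) p. 23] -/
theorem truncEnergy_nearby_reduction_of_cor33_location (h50 : RodgersTao2020.cor33_location)
    {t₀ : ℝ} (ht₀ : t₀ < 0) (hreal : HasOnlyRealZeros (deBruijnH t₀)) {ε : ℝ} (hε : 0 < ε) :
    ∃ T₁ : ℝ, 3 ≤ T₁ ∧ ∀ T : ℝ, T₁ ≤ T → ∀ t ∈ Icc (t₀ / 2) 0,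
      Summable (fun p : nearbyPairs T ↦ truncWeight T p.1.1 * truncWeight T p.1.2 /
          (classicalLocationZ p.1.2 - classicalLocationZ p.1.1) ^ 2) ∧
      (Summable (truncEnergyTerm T t) ↔
        Summable (fun p : nearbyPairs T ↦
          truncWeight T p.1.1 * truncWeight T p.1.2 * interactionEnergy t p.1.1 p.1.2)) ∧
      (Summable (truncEnergyTerm T t) →
        |truncEnergy T t -
            (∑' p : nearbyPairs T,
                truncWeight T p.1.1 * truncWeight T p.1.2 * interactionEnergy t p.1.1 p.1.2 -
              ∑' p : nearbyPairs T, truncWeight T p.1.1 * truncWeight T p.1.2 /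
                (classicalLocationZ p.1.2 - classicalLocationZ p.1.1) ^ 2)| ≤
          ε * (T * Real.log T ^ 3)) := by
  obtain ⟨A, hA⟩ := h50
  obtain ⟨T₁, hT₁3, h⟩ := truncEnergy_nearby_reduction A ε hε
  refine ⟨T₁, hT₁3, fun T hT t ht ↦ ?_⟩
  have hΛ : ∃ t₁ : ℝ, t₁ < t ∧ HasOnlyRealZeros (deBruijnH t₁) := ⟨t₀, by linarith [ht.1], hreal⟩
  exact h T t hT hΛ (fun n hn ↦ hA t hΛ ht.2 n hn)


end Literature.NumberTheory.LFunctions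

end
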